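/-
Copyright: the b2b-balaban T⁴-continuum CRUX team, row NE7b OWNER lineage `t4-ne7b-p1` (gen 125). Project licence.
-/
import Summits.QuantumFields.BalabanUV.T4Continuum.Spine.NE7b.SupZdPerturbedHessianTorusLimit
import Mathlib.Analysis.Normed.Group.Tannery

/-!
# THE THERMODYNAMIC LIMIT OF THE PERTURBED RESPONSE: along the tower `3^k`, the torus `H[V∘wm_k] + K(wm·,wm·)` road's response to a unit
# coarse source, `Σ_{y′}(T^{tor}_{K,k})⁻¹(y′, σ_k b₀)ψ^k_{y′}(σ_k p)`, CONVERGES for every `b₀, p ∈ ℤ^d` to the infinite-volume perturbed response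
# `h^K_{b₀}(p) = Σ′_{b′}N_K(b′,b₀)Ψ^K_{b′}(p)` of (220)∕(222) — for ANY `ℤ^d` objects `Ψ^K, N_K` with (234)'s displayed clauses, `K` symmetric of
# the class with `εK_{γ−1} ≤ (min(2,a)−λ)∕4`, every `V : ℤ^d → [−λ, Λ]`, `d ≥ 3`, every mesh; Tannery's theorem over `b′ ∈ ℤ^d` with (243)'s
# convergence of `(T^{tor}_{K,k})⁻¹`, (240)'s of the torus block columns, and the uniform domination `c₁C_se^{δ₁|b₀|₁}e^{−δ₁|b′|₁}` from (166)'s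
# volume-free decay of `(T^{tor}_K)⁻¹` and (167)'s sup bound.  The `H + K` twin of (204) (row NE7b, node U5c; (166)∕(167)∕(240)∕(243) BY
# NAME; [folklore])

Cell `pub-balaban`, sub-cell `t4`, spine estimate NE7b (`T4WeightBudget.RelWeightBound`; the cell's OWN estimate — NOT PRINTED in
[Bałaban 1983–89], NOT PROVED).  Crux-route work under `Spine/NE7b/` by the row OWNER (`t4-ne7b-p1` gen 125, file (244)) under FREEZE
(0)'s crux-prover clause; NOTHING of Bałaban's is named as a Lean object, valued or asserted; no `T4Continuum/Support` leaf typed; no `def`,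
no notation; zero `sorry`.  Imports (BY NAME): the OWNER's (243) `…SupZdPerturbedHessianTorusLimit` (`zd_perturbed_hessian_torus_limit`,
`torus_kernel_class`; through it (240) `zd_perturbed_coarse_seam_row`, (242) `exp_bound_tendsto_zero`, (166) `perturbed_nextScale_hessian_local`,
(167) `perturbed_supNorm_bound`, (186) `sum_window_reading`, (197) `torusNorm_eq_l1`, (180) `torusNorm_le_l1`, `inWindow_of_le`,
SupTorusBlockDistance `isPseudoDist_torus`, (189) `summable_exp_l1`, (27) `mem_B`), Mathlib's `tendsto_tsum_of_dominated_convergence`.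

WHY (located).  (243) made `N_K` the limit of the torus perturbed next-scale Hessians; the road's other next-scale object is the
response `Σ_{y′}(T^{tor}_K)⁻¹(y′,y₀)ψ^K_{y′}` (torus, finite) ∕ `Σ′_{b′}N_K(b′,b₀)Ψ^K_{b′}` ((220), `ℤ^d`).  Reading the torus sum through the window
makes it a `ℤ^d` series with window-supported terms ((186)); each term converges — `(T^{tor}_{K,k})⁻¹(σb′,σb₀) → N_K(b′,b₀)` by (243) and
`ψ^k_{σb′}(σp) → Ψ^K_{b′}(p)` by (240)'s pointwise seam bound on the block of `blk n p` — and the terms are dominated uniformly in `k` by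
`c₁e^{−δ₁ρ_k(σb′,σb₀)}·C_s` ((166), (167)) with `ρ_k(σb′,σb₀) ≥ |b′|₁ − |b₀|₁` on the window; Tannery.

WHAT IS PROVED ([folklore]): §1 `window_term_dominated`, `torus_sum_as_series`, `tendsto_of_exp_close` (bookkeeping); §2 **`zd_perturbed_response_torus_limit`** (`∃ C₀ C_P δ₀ ε₀ > 0` from `(d, a, λ, Λ, γ)`: for ALL `ε ≤ ε₀`, `μ` under
(240)'s smallness conditions and `εK_{γ−1} ≤ (min(2,a)−λ)∕4`, ALL letters of the `ℤ^d` objects, ALL `n, V, K, Ψ^K, N_K, ψ^k, b₀, p`: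
`Σ_{y′}(T^{tor}_{K,k})⁻¹(y′,σ_kb₀)ψ^k_{y′}(σ_kp) → Σ′_{b′}N_K(b′,b₀)Ψ^K_{b′}(p)`); §2 toy.

HONEST (what this is NOT).  Pointwise convergence of the response to unit coarse sources (no rate typed); the covariance's torus limit
((206)'s twin) is the by-name sequel; `d ≥ 3`; `K` symmetric; scalar skeleton ((A3), NC-NE7b-α UNRULED); nothing of the covariant
propagators of [B4]–[B6]; nothing of Bałaban's asserted.  BY-NAME EFFECT ON THE WALL: NONE.  NE7b NOT PRINTED ∕ NOT PROVED; spine PROVED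
0∕9; rung (B)+1 — the programme's measures remain FINITE-torus statements; NOT the mass gap, NOT Clay.  HONEST DEPENDENCY: continuum YM
on T⁴ ⇐ BetaPertH ∧ nine spine estimates (0∕9 proved); BetaPertH ⇐ (D1) ∧ (D4) ∧ CAP+tail; G-an2-4 gates asym, D1 and NE2∕3∕4.
-/

set_option autoImplicit false

noncomputable section

namespace Summit.QuantumFields.BalabanUV.T4Continuum.NE7b.SupZdPerturbedResponseTorusLimit

open Real Filter Topology
open Literature.MathematicalPhysics.QuantumFieldTheory.Balaban1983to89
open B6QGQLower276 (X e blk B chart mem_B sum_B sum_B_const blk_chart chart_mem_B locFin chart_blk_locFin)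
open Beta (Site siteOf windowMap siteOf_windowMap windowMap_siteOf)
open SupTorusBlockDistance (isPseudoDist_torus)
open SupTorusPerturbedCoarseFloor (perturbed_nextScale_hessian_local)
open SupTorusPerturbedSupNorm (perturbed_supNorm_bound)
open SupZdPropagatorLimit (torusNorm_le_l1 inWindow_of_le)
open SupZdCoarseOperator (sum_window_reading)
open SupZdExponentialSums (summable_exp_l1)
open SupZdCoarseTorusSeam (torusNorm_eq_l1)
open SupZdPerturbedColumn (K_pos)
open SupZdPerturbedCoarseTorusSeamRow (zd_perturbed_coarse_seam_row)
open SupZdKernelTorusLimit (exp_bound_tendsto_zero)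
open SupZdPerturbedHessianTorusLimit (zd_perturbed_hessian_torus_limit torus_kernel_class)

variable {d : ℕ}

/-! ## §1. Three bookkeeping lemmas (kept out of the headline's context) -/

/-- **DOMINATION OF ONE WINDOW TERM**: `|Tinv(y,y′)| ≤ c_te^{−δ_tρ(y,y′)}`, `|ψ_{y′}(x)| ≤ B_u` ⟹ the window-supported term
`𝟙[wm σb′ = b′]·Tinv(σb′,σb₀)ψ_{σb′}(σp)` is bounded by `c_te^{δ_t|b₀|₁}B_u·e^{−δ_t|b′|₁}` (`ρ(σb′,σb₀) ≥ |b′|₁ − |b₀|₁` on the window). [folklore] -/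
theorem window_term_dominated (n k : ℕ) {ct δt Bu : ℝ} (hct : 0 ≤ ct) (hδt : 0 ≤ δt) (hBu : 0 ≤ Bu)
    (Tinv : Site d (3 ^ k) → Site d (3 ^ k) → ℝ) (ψ : Site d (3 ^ k) → Site d ((n + 1) * 3 ^ k) → ℝ)
    (hTB : ∀ y y', |Tinv y y'| ≤ ct * exp (-(δt * ∑ i, (((y i - y' i).valMinAbs.natAbs : ℕ) : ℝ))))
    (hψB : ∀ y' x, |ψ y' x| ≤ Bu) (b₀ p b' : X d) :
    ‖(if windowMap d (3 ^ k) (siteOf d (3 ^ k) b') = b' then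
        Tinv (siteOf d (3 ^ k) b') (siteOf d (3 ^ k) b₀) * ψ (siteOf d (3 ^ k) b') (siteOf d ((n + 1) * 3 ^ k) p) else 0)‖
      ≤ ct * exp (δt * ∑ i, (((b₀ i).natAbs : ℕ) : ℝ)) * Bu * exp (-(δt * ∑ i, ((((0 : X d) i - b' i).natAbs : ℕ) : ℝ))) := by
  rw [Real.norm_eq_abs]
  split_ifs with hwin
  · rw [abs_mul]
    have e1 := hTB (siteOf d (3 ^ k) b') (siteOf d (3 ^ k) b₀)
    have e2 := hψB (siteOf d (3 ^ k) b') (siteOf d ((n + 1) * 3 ^ k) p)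
    have htri := (isPseudoDist_torus (d := d) (3 ^ k)).triangle (siteOf d (3 ^ k) b') (siteOf d (3 ^ k) b₀) 0
    have hN0 : ∀ y : Site d (3 ^ k), ∑ i, (((y i - (0 : Site d (3 ^ k)) i).valMinAbs.natAbs : ℕ) : ℝ)
        = ∑ i, ((((y i).valMinAbs).natAbs : ℕ) : ℝ) := fun y => Finset.sum_congr rfl fun i _ => by simp
    rw [hN0, hN0, torusNorm_eq_l1 k (siteOf d (3 ^ k) b'), hwin] at htri
    have e3 := torusNorm_le_l1 (d := d) (3 ^ k) b₀
    have hb'0 : ∑ i, ((((0 : X d) i - b' i).natAbs : ℕ) : ℝ) = ∑ i, (((b' i).natAbs : ℕ) : ℝ) :=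
      Finset.sum_congr rfl fun i _ => by simp
    rw [hb'0]
    have e4 : ct * exp (-(δt * ∑ i, ((((siteOf d (3 ^ k) b') i - (siteOf d (3 ^ k) b₀) i).valMinAbs.natAbs : ℕ) : ℝ)))
        ≤ ct * exp (δt * ∑ i, (((b₀ i).natAbs : ℕ) : ℝ)) * exp (-(δt * ∑ i, (((b' i).natAbs : ℕ) : ℝ))) := by
      rw [mul_assoc, ← exp_add]
      exact mul_le_mul_of_nonneg_left (exp_le_exp.2 (by nlinarith)) hct
    calc |Tinv (siteOf d (3 ^ k) b') (siteOf d (3 ^ k) b₀)| * |ψ (siteOf d (3 ^ k) b') (siteOf d ((n + 1) * 3 ^ k) p)|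
        ≤ (ct * exp (δt * ∑ i, (((b₀ i).natAbs : ℕ) : ℝ)) * exp (-(δt * ∑ i, (((b' i).natAbs : ℕ) : ℝ)))) * Bu :=
          mul_le_mul (e1.trans e4) e2 (abs_nonneg _) (by positivity)
      _ = _ := by ring
  · rw [abs_zero]; positivity

/-- **THE TORUS RESPONSE SUM IS THE `ℤ^d` SERIES OF ITS WINDOW TERMS** ((186) `sum_window_reading`). [folklore] -/
theorem torus_sum_as_series (n k : ℕ) (Tinv : Site d (3 ^ k) → Site d (3 ^ k) → ℝ) (ψ : Site d (3 ^ k) → Site d ((n + 1) * 3 ^ k) → ℝ)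
    (b₀ p : X d) :
    ∑ y' : Site d (3 ^ k), Tinv y' (siteOf d (3 ^ k) b₀) * ψ y' (siteOf d ((n + 1) * 3 ^ k) p)
      = ∑' b' : X d, (if windowMap d (3 ^ k) (siteOf d (3 ^ k) b') = b' then
          Tinv (siteOf d (3 ^ k) b') (siteOf d (3 ^ k) b₀) * ψ (siteOf d (3 ^ k) b') (siteOf d ((n + 1) * 3 ^ k) p) else 0) := by
  classical
  have hWrep : ∀ b' ∈ (Finset.univ : Finset (Site d (3 ^ k))).image (windowMap d (3 ^ k)),
      windowMap d (3 ^ k) (siteOf d (3 ^ k) b') = b' := fun b' hb' => by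
    obtain ⟨y, -, hy⟩ := Finset.mem_image.1 hb'; rw [← hy, siteOf_windowMap]
  have hF0 : ∀ b', b' ∉ (Finset.univ : Finset (Site d (3 ^ k))).image (windowMap d (3 ^ k)) →
      (if windowMap d (3 ^ k) (siteOf d (3 ^ k) b') = b' then
        Tinv (siteOf d (3 ^ k) b') (siteOf d (3 ^ k) b₀) * ψ (siteOf d (3 ^ k) b') (siteOf d ((n + 1) * 3 ^ k) p) else 0) = 0 := by
    intro b' hb'
    rw [if_neg]
    intro h
    exact hb' (Finset.mem_image.2 ⟨siteOf d (3 ^ k) b', Finset.mem_univ _, h⟩)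
  rw [tsum_eq_sum (s := (Finset.univ : Finset (Site d (3 ^ k))).image (windowMap d (3 ^ k))) (fun b' hb' => hF0 b' hb'),
    ← sum_window_reading (3 ^ k) _ hWrep _ hF0]
  refine Finset.sum_congr rfl fun y' _ => ?_
  rw [if_pos (by rw [siteOf_windowMap]), siteOf_windowMap]

/-- **A SEQUENCE WITHIN AN EXPONENTIALLY VANISHING DISTANCE OF A CONSTANT CONVERGES TO IT.** [folklore] -/
theorem tendsto_of_exp_close {u : ℕ → ℝ} {L C a q B : ℝ} (ha : 0 < a) (hq : 0 < q) (k₁ : ℕ)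
    (h : ∀ k, k₁ ≤ k → |u k - L| ≤ C * exp (-(a * (q * ((3 ^ k : ℕ) : ℝ) - B)))) : Tendsto u atTop (𝓝 L) := by
  have hg := exp_bound_tendsto_zero C a q B ha hq
  have hlo : Tendsto (fun k : ℕ => L - C * exp (-(a * (q * ((3 ^ k : ℕ) : ℝ) - B)))) atTop (𝓝 L) := by
    simpa only [sub_zero] using (tendsto_const_nhds (x := L) (f := (atTop : Filter ℕ))).sub hg
  have hhi : Tendsto (fun k : ℕ => L + C * exp (-(a * (q * ((3 ^ k : ℕ) : ℝ) - B)))) atTop (𝓝 L) := by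
    simpa only [add_zero] using (tendsto_const_nhds (x := L) (f := (atTop : Filter ℕ))).add hg
  refine tendsto_of_tendsto_of_tendsto_of_le_of_le' hlo hhi (Filter.eventually_atTop.2 ⟨k₁, fun k hk => ?_⟩)
    (Filter.eventually_atTop.2 ⟨k₁, fun k hk => ?_⟩)
  · have h' := (abs_le.1 (h k hk)).1; linarith
  · have h' := (abs_le.1 (h k hk)).2; linarith

/-! ## §2. THE END: the torus perturbed responses converge to the infinite-volume one -/

/-- **HEADLINE — `Σ_{y′}(T^{tor}_{K,k})⁻¹(y′, σ_k b₀)ψ^k_{y′}(σ_k p) → Σ′_{b′}N_K(b′,b₀)Ψ^K_{b′}(p)` AS `k → ∞`.**  `d ≥ 3`, `a > 0`, `λ < min(2,a)`,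
`Λ ≥ 0`, `γ > 1` ⟹ `∃ C₀ C_P δ₀ ε₀ > 0` such that for ALL `0 ≤ ε ≤ ε₀`, `0 < μ < min(δ₀, γ)` under the two smallness conditions and
`εK_{γ−1} ≤ (min(2,a)−λ)∕4`, ALL letters `γ_z, C_z > 0`, `C_Ψ, C_N ≥ 0`, `ν > 0`, ALL `n`, `V : ℤ^d → [−λ, Λ]`, SYMMETRIC `K` of the class, ANY `Ψ^K`
(perturbed block-column equations, `|Ψ^K| ≤ C_Ψ`, `T_K` symmetric∕coercive∕local), ANY `N_K` (decaying, `T_KN_K = 1`), ANY torus block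
columns `ψ^k` of `H[V∘wm_k] + K(wm·,wm·)`, and all `b₀, p ∈ ℤ^d`: the torus responses converge to the `ℤ^d` response. [folklore] -/
theorem zd_perturbed_response_torus_limit (hd : 3 ≤ d) (a : ℝ) (ha : 0 < a) {lam Lam γ : ℝ} (hlam : lam < min 2 a) (hLam : 0 ≤ Lam)
    (hγ : 1 < γ) :
    ∃ C₀ CP δ₀ ε₀ : ℝ, 0 < C₀ ∧ 0 < CP ∧ 0 < δ₀ ∧ 0 < ε₀ ∧
    ∀ (ε μ : ℝ), 0 ≤ ε → ε ≤ ε₀ → 0 < μ → μ < δ₀ → μ < γ →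
      ε * (2 * (1 - exp (-γ))⁻¹) ^ d * C₀ ≤ 1 / 2 →
      (CP * (2 * (1 - exp (-(δ₀ - μ)))⁻¹) ^ d) * (ε * exp (μ * d) * (2 * (1 - exp (-(γ - μ)))⁻¹) ^ d) ≤ 1 / 2 →
      ε * (2 * (1 - exp (-(γ - 1)))⁻¹) ^ d ≤ (min 2 a - lam) / 4 →
    ∀ (γz Cz CΨ CN ν : ℝ), 0 < γz → 0 < Cz → 0 ≤ CΨ → 0 ≤ CN → 0 < ν →
    ∀ (n : ℕ) (V : X d → ℝ), (∀ p, -lam ≤ V p) → (∀ p, V p ≤ Lam) →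
    ∀ (K : X d → X d → ℝ), (∀ p q, |K p q| ≤ ε * exp (-(γ * ∑ i, (((p i - q i).natAbs : ℕ) : ℝ)))) → (∀ p q, K p q = K q p) →
    ∀ (ΨK N : X d → X d → ℝ),
      (∀ c p, ((n : ℝ) + 1) ^ 2 * ∑ μ', (2 * ΨK c p - ΨK c (p + e μ') - ΨK c (p - e μ'))
        + a / ((n : ℝ) + 1) ^ d * ∑ q ∈ B n (blk n p), ΨK c q + V p * ΨK c p + ∑' q : X d, K p q * ΨK c q
          = if blk n p = c then 1 else 0) →
      (∀ c p, |ΨK c p| ≤ CΨ) →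
      (∀ b c, (((n : ℝ) + 1) ^ d)⁻¹ * ∑ q ∈ B n b, ΨK c q = (((n : ℝ) + 1) ^ d)⁻¹ * ∑ q ∈ B n c, ΨK b q) →
      (∀ (S : Finset (X d)) (g : X d → ℝ), (∀ b, b ∉ S → g b = 0) →
        γz * ∑ b ∈ S, g b ^ 2 ≤ ∑ b ∈ S, g b * ∑ c ∈ S, ((((n : ℝ) + 1) ^ d)⁻¹ * ∑ q ∈ B n b, ΨK c q) * g c) →
      (∀ b c, |(((n : ℝ) + 1) ^ d)⁻¹ * ∑ q ∈ B n b, ΨK c q| ≤ Cz * exp (-(μ * ∑ i, (((b i - c i).natAbs : ℕ) : ℝ)))) →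
      (∀ b c, |N b c| ≤ CN * exp (-(ν * ∑ i, (((b i - c i).natAbs : ℕ) : ℝ)))) →
      (∀ b c, ∑' b' : X d, ((((n : ℝ) + 1) ^ d)⁻¹ * ∑ q ∈ B n b, ΨK b' q) * N b' c = if b = c then 1 else 0) →
    ∀ (ψ : (k : ℕ) → Site d (3 ^ k) → Site d ((n + 1) * 3 ^ k) → ℝ),
      (∀ (k : ℕ) (y' : Site d (3 ^ k)) (x : Site d ((n + 1) * 3 ^ k)),
        ((n : ℝ) + 1) ^ 2 * ∑ μ', (2 * ψ k y' x - ψ k y' (x + siteOf d ((n + 1) * 3 ^ k) (e μ'))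
          - ψ k y' (x - siteOf d ((n + 1) * 3 ^ k) (e μ')))
        + a / ((n : ℝ) + 1) ^ d * ∑ q ∈ B n (blk n (windowMap d ((n + 1) * 3 ^ k) x)), ψ k y' (siteOf d ((n + 1) * 3 ^ k) q)
        + V (windowMap d ((n + 1) * 3 ^ k) x) * ψ k y' x
        + ∑ z, K (windowMap d ((n + 1) * 3 ^ k) x) (windowMap d ((n + 1) * 3 ^ k) z) * ψ k y' z
        = if siteOf d (3 ^ k) (blk n (windowMap d ((n + 1) * 3 ^ k) x)) = y' then 1 else 0) →
    ∀ b₀ p : X d,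
      Tendsto (fun k : ℕ => ∑ y' : Site d (3 ^ k), (Matrix.of fun y y' : Site d (3 ^ k) => (((n : ℝ) + 1) ^ d)⁻¹
          * ∑ z : Fin d → Fin (n + 1), ψ k y' (siteOf d ((n + 1) * 3 ^ k) (chart n (windowMap d (3 ^ k) y) z)))⁻¹
          y' (siteOf d (3 ^ k) b₀) * ψ k y' (siteOf d ((n + 1) * 3 ^ k) p)) atTop
        (𝓝 (∑' b' : X d, N b' b₀ * ΨK b' p)) := by
  classical
  have hγ0 : 0 < γ := by linarith
  have hm0 : 0 < min 2 a - lam := by linarith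
  obtain ⟨C₀, CP, δ₀, ε₀, hC₀, hCP, hδ₀, hε₀, H243⟩ := zd_perturbed_hessian_torus_limit (d := d) hd a ha hlam hLam hγ
  obtain ⟨C₀', CP', δ₀', hC₀', hCP', hδ₀', H240⟩ := zd_perturbed_coarse_seam_row (d := d) hd a ha hlam hLam
  obtain ⟨ε₁, Csup, hε₁, hCsup, H167⟩ := perturbed_supNorm_bound (d := d) hd a ha hlam hLam hγ0
  -- one set of smallness letters: the larger `C₀`, `C_P`, the smaller `δ₀`, `ε₀`
  refine ⟨max C₀ C₀', max CP CP', min δ₀ δ₀', min ε₀ ε₁, lt_max_of_lt_left hC₀, lt_max_of_lt_left hCP, lt_min hδ₀ hδ₀',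
    lt_min hε₀ hε₁, ?_⟩
  intro ε μ hε hεε hμ hμδ hμγ hs1 hs2 hεs γz Cz CΨ CN ν hγz hCz hCΨ hCN hν n V hV hV' K hK hKs ΨK N hA3 hA4 hD1 hE1 hE0 hC1 hC2
    ψ hψ b₀ p
  have hKγ : 0 < (2 * (1 - exp (-γ))⁻¹) ^ d := K_pos (d := d) hγ0
  have hKγμ : 0 < (2 * (1 - exp (-(γ - μ)))⁻¹) ^ d := K_pos (d := d) (sub_pos.2 hμγ)
  -- the smallness conditions at each triple
  have hsm : ∀ (C δ : ℝ), 0 < C → C ≤ max C₀ C₀' ∨ True → C ≤ max CP CP' → min δ₀ δ₀' ≤ δ → μ < δ →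
      (C * (2 * (1 - exp (-(δ - μ)))⁻¹) ^ d) * (ε * exp (μ * d) * (2 * (1 - exp (-(γ - μ)))⁻¹) ^ d) ≤ 1 / 2 := by
    intro C δ hC _ hCle hδle hμδ'
    have hKδ : (2 * (1 - exp (-(δ - μ)))⁻¹) ^ d ≤ (2 * (1 - exp (-(min δ₀ δ₀' - μ)))⁻¹) ^ d :=
      SupTorusPerturbedResponse.kernelSum_anti (d := d) (by linarith) (by linarith)
    have h0 : 0 ≤ ε * exp (μ * d) * (2 * (1 - exp (-(γ - μ)))⁻¹) ^ d := by positivity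
    have hKm : 0 < (2 * (1 - exp (-(min δ₀ δ₀' - μ)))⁻¹) ^ d := K_pos (d := d) (by linarith)
    calc (C * (2 * (1 - exp (-(δ - μ)))⁻¹) ^ d) * (ε * exp (μ * d) * (2 * (1 - exp (-(γ - μ)))⁻¹) ^ d)
        ≤ (max CP CP' * (2 * (1 - exp (-(min δ₀ δ₀' - μ)))⁻¹) ^ d) * (ε * exp (μ * d) * (2 * (1 - exp (-(γ - μ)))⁻¹) ^ d) :=
          mul_le_mul_of_nonneg_right (mul_le_mul hCle hKδ (K_pos (d := d) (by linarith)).le (hC.le.trans hCle)) h0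
      _ ≤ 1 / 2 := hs2
  have hs1a : ε * (2 * (1 - exp (-γ))⁻¹) ^ d * C₀ ≤ 1 / 2 :=
    (mul_le_mul_of_nonneg_left (le_max_left _ _) (by positivity)).trans hs1
  have hs1b : ε * (2 * (1 - exp (-γ))⁻¹) ^ d * C₀' ≤ 1 / 2 :=
    (mul_le_mul_of_nonneg_left (le_max_right _ _) (by positivity)).trans hs1
  have hs2a := hsm CP δ₀ hCP (Or.inr trivial) (le_max_left _ _) (min_le_left _ _) (lt_of_lt_of_le hμδ (min_le_left _ _))
  have hs2b := hsm CP' δ₀' hCP' (Or.inr trivial) (le_max_right _ _) (min_le_right _ _) (lt_of_lt_of_le hμδ (min_le_right _ _))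
  have hμδ₀ : μ < δ₀ := lt_of_lt_of_le hμδ (min_le_left _ _)
  have hμδ₀' : μ < δ₀' := lt_of_lt_of_le hμδ (min_le_right _ _)
  have hεε₀ : ε ≤ ε₀ := hεε.trans (min_le_left _ _)
  have hεε₁ : ε ≤ ε₁ := hεε.trans (min_le_right _ _)
  -- (243): the inverse kernels converge; (166): they decay uniformly; (167): the columns are bounded
  obtain ⟨c₁, δ₁, c₂, δ₂, -, -, -, -, HN⟩ := H243 ε μ hε hεε₀ hμ hμδ₀ hμγ hs1a hs2a hεs γz Cz CΨ CN ν hγz hCz hCΨ hCN hν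
  have hNlim := fun b b' => (HN n V hV hV' K hK hKs ΨK N hA3 hA4 hD1 hE1 hE0 hC1 hC2 ψ hψ b b').2
  obtain ⟨ct, δt, hct, hδt, H166⟩ := perturbed_nextScale_hessian_local (d := d) a ha hm0 hLam hε hγ hεs
  have hKt : ∀ (k : ℕ) (x z : Site d ((n + 1) * 3 ^ k)), |K (windowMap d ((n + 1) * 3 ^ k) x) (windowMap d ((n + 1) * 3 ^ k) z)|
      ≤ ε * exp (-(γ * ∑ i, (((x i - z i).valMinAbs.natAbs : ℕ) : ℝ))) := fun k x z => torus_kernel_class _ hγ0.le K hK x z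
  have hKt₁ : ∀ (k : ℕ) (x z : Site d ((n + 1) * 3 ^ k)), |K (windowMap d ((n + 1) * 3 ^ k) x) (windowMap d ((n + 1) * 3 ^ k) z)|
      ≤ ε₁ * exp (-(γ * ∑ i, (((x i - z i).valMinAbs.natAbs : ℕ) : ℝ))) := fun k x z =>
    (hKt k x z).trans (mul_le_mul_of_nonneg_right hεε₁ (exp_pos _).le)
  have hKts : ∀ (k : ℕ) (x z : Site d ((n + 1) * 3 ^ k)), K (windowMap d ((n + 1) * 3 ^ k) x) (windowMap d ((n + 1) * 3 ^ k) z)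
      = K (windowMap d ((n + 1) * 3 ^ k) z) (windowMap d ((n + 1) * 3 ^ k) x) := fun k x z => hKs _ _
  -- abbreviations
  obtain ⟨Tinv, hTinv⟩ : ∃ Tinv : (k : ℕ) → Site d (3 ^ k) → Site d (3 ^ k) → ℝ, ∀ k y y', Tinv k y y' =
      (Matrix.of fun y y' : Site d (3 ^ k) => (((n : ℝ) + 1) ^ d)⁻¹ * ∑ z : Fin d → Fin (n + 1),
        ψ k y' (siteOf d ((n + 1) * 3 ^ k) (chart n (windowMap d (3 ^ k) y) z)))⁻¹ y y' := ⟨_, fun _ _ _ => rfl⟩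
  obtain ⟨F, hF⟩ : ∃ F : ℕ → X d → ℝ, ∀ k b', F k b' =
      if windowMap d (3 ^ k) (siteOf d (3 ^ k) b') = b' then
        Tinv k (siteOf d (3 ^ k) b') (siteOf d (3 ^ k) b₀) * ψ k (siteOf d (3 ^ k) b') (siteOf d ((n + 1) * 3 ^ k) p) else 0 :=
    ⟨_, fun _ _ => rfl⟩
  have hψB : ∀ k y' x, |ψ k y' x| ≤ Csup * 1 := fun k y' x =>
    H167 n (3 ^ k) (fun x => V (windowMap d ((n + 1) * 3 ^ k) x)) (fun x => hV _) (fun x => hV' _)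
      (fun x z => K (windowMap d ((n + 1) * 3 ^ k) x) (windowMap d ((n + 1) * 3 ^ k) z)) (hKt₁ k) 1 (ψ k y')
      (fun x => if siteOf d (3 ^ k) (blk n (windowMap d ((n + 1) * 3 ^ k) x)) = y' then (1 : ℝ) else 0)
      (fun x => by split_ifs <;> simp) (hψ k y') x
  have hTB : ∀ k (y y' : Site d (3 ^ k)), |Tinv k y y'| ≤ ct * exp (-(δt * ∑ i, (((y i - y' i).valMinAbs.natAbs : ℕ) : ℝ))) :=
    fun k y y' => by
      rw [hTinv]
      exact H166 n (3 ^ k) (fun x => V (windowMap d ((n + 1) * 3 ^ k) x)) (fun x => hV _) (fun x => hV' _)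
        (fun x z => K (windowMap d ((n + 1) * 3 ^ k) x) (windowMap d ((n + 1) * 3 ^ k) z)) (hKts k) (hKt k) (ψ k) (hψ k) y y'
  -- the torus sum IS the `ℤ^d` series of `F k`
  have hsum : ∀ k : ℕ, ∑ y' : Site d (3 ^ k), Tinv k y' (siteOf d (3 ^ k) b₀) * ψ k y' (siteOf d ((n + 1) * 3 ^ k) p)
      = ∑' b' : X d, F k b' := fun k => by
    rw [torus_sum_as_series n k (Tinv k) (ψ k) b₀ p]; exact tsum_congr fun b' => by rw [hF]
  -- termwise convergence
  have hlim : ∀ b' : X d, Tendsto (fun k => F k b') atTop (𝓝 (N b' b₀ * ΨK b' p)) := by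
    intro b'
    have h1 : Tendsto (fun k => Tinv k (siteOf d (3 ^ k) b') (siteOf d (3 ^ k) b₀)) atTop (𝓝 (N b' b₀)) := by
      refine (hNlim b' b₀).congr fun k => ?_
      rw [hTinv]
    -- the block column, by (240)'s pointwise seam on the block of `blk n p`
    obtain ⟨k₁, hk₁⟩ : ∃ k₁ : ℕ, k₁ = 2 * (∑ i, (b' i).natAbs + ∑ i, (blk n p i).natAbs) + 1 := ⟨_, rfl⟩
    have hwin : ∀ k, k₁ ≤ k → ∀ c' : X d, ∑ i, (c' i).natAbs ≤ ∑ i, (b' i).natAbs + ∑ i, (blk n p i).natAbs →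
        windowMap d (3 ^ k) (siteOf d (3 ^ k) c') = c' := fun k hk c' hc' =>
      windowMap_siteOf d (3 ^ k) fun i => by
        have h := inWindow_of_le 0 k c' (by omega) i
        simpa using h
    obtain ⟨Cb, hCb⟩ : ∃ Cb : ℝ, Cb = (2 * (CP' * (2 * (1 - exp (-(δ₀' - μ)))⁻¹) ^ d) * (2 * (1 - exp (-(μ / 2)))⁻¹) ^ d)
          * (ε * (2 * (1 - exp (-(γ / 2)))⁻¹) ^ d * exp (γ / 2 * d) * CΨ)
        + (2 * (CP' * (2 * (1 - exp (-(δ₀' - μ)))⁻¹) ^ d) * (2 * (1 - exp (-(μ / 2)))⁻¹) ^ d)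
          * ((2 + 2 * (|lam| + Lam) * (2 * (CP' * (2 * (1 - exp (-(δ₀' - μ)))⁻¹) ^ d) * (2 * (1 - exp (-(μ / 2)))⁻¹) ^ d))
            * (1 + 2 * (ε * (2 * (1 - exp (-γ))⁻¹) ^ d) * (Csup * 1 + CΨ))) := ⟨_, rfl⟩
    have hcol : ∀ k, k₁ ≤ k → |ψ k (siteOf d (3 ^ k) b') (siteOf d ((n + 1) * 3 ^ k) p) - ΨK b' p|
        ≤ Cb * exp (-(μ / 2 / 2 * ((1 / 2) * ((3 ^ k : ℕ) : ℝ) - (2 + ∑ i, (((blk n p i).natAbs : ℕ) : ℝ))))) := by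
      intro k hk
      have h := (H240 n k V hV hV' ε γ μ hε hμ hμδ₀' hμγ hs1b hs2b K hK (ψ k) (Csup * 1) (hψB k) (hψ k) ΨK CΨ hA4 hA3
        (siteOf d (3 ^ k) (blk n p)) (siteOf d (3 ^ k) b')).1 p
        (by rw [hwin k hk (blk n p) (by omega)]; exact mem_B.2 rfl)
      rw [hwin k hk b' (by omega), ← hCb] at h
      refine h.trans (mul_le_mul_of_nonneg_left (exp_le_exp.2 ?_) ?_)
      · have e1 := le_max_right 0 ((((3 ^ k : ℕ) : ℝ) / 2 - 2
          - ∑ i, (((((siteOf d (3 ^ k) (blk n p)) i).valMinAbs).natAbs : ℕ) : ℝ)) / 2)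
        have e2 := torusNorm_le_l1 (d := d) (3 ^ k) (blk n p)
        nlinarith
      · have := (abs_nonneg _).trans h
        rcases (mul_nonneg_iff_of_pos_right (exp_pos _)).1 this with h' ; exact h'
    have h2 : Tendsto (fun k => ψ k (siteOf d (3 ^ k) b') (siteOf d ((n + 1) * 3 ^ k) p)) atTop (𝓝 (ΨK b' p)) :=
      tendsto_of_exp_close (by linarith) (by norm_num) k₁ hcol
    refine (h1.mul h2).congr' (Filter.eventually_atTop.2 ⟨k₁, fun k hk => ?_⟩)
    beta_reduce; rw [hF, if_pos (hwin k hk b' (by omega))]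
  -- summable domination, uniform in `k`
  have hdom : ∀ k b', ‖F k b'‖ ≤ ct * exp (δt * ∑ i, (((b₀ i).natAbs : ℕ) : ℝ)) * (Csup * 1)
      * exp (-(δt * ∑ i, ((((0 : X d) i - b' i).natAbs : ℕ) : ℝ))) := fun k b' => by
    rw [hF]; exact window_term_dominated n k hct.le hδt.le (by positivity) (Tinv k) (ψ k) (hTB k) (hψB k) b₀ p b'
  have hbsum : Summable fun b' : X d => ct * exp (δt * ∑ i, (((b₀ i).natAbs : ℕ) : ℝ)) * (Csup * 1)
      * exp (-(δt * ∑ i, ((((0 : X d) i - b' i).natAbs : ℕ) : ℝ))) := (summable_exp_l1 hδt 0).mul_left _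
  have hT := tendsto_tsum_of_dominated_convergence hbsum hlim (Eventually.of_forall hdom)
  refine hT.congr fun k => ?_
  rw [← hsum k]
  exact Finset.sum_congr rfl fun y' _ => by rw [hTinv]

/-! ## §2. Toy -/

/-- Toy (`d = 3`, `a = 1`, `λ = 0`, `Λ = 1`, `γ = 2`): the four tree constants exist. -/
example : ∃ C₀ CP δ₀ ε₀ : ℝ, 0 < C₀ ∧ 0 < CP ∧ 0 < δ₀ ∧ 0 < ε₀ :=
  let ⟨C₀, CP, δ₀, ε₀, h1, h2, h3, h4, _⟩ := zd_perturbed_response_torus_limit (d := 3) le_rfl 1 one_pos (lam := 0) (Lam := 1) (γ := 2)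
    (by rw [min_eq_right (by norm_num : (1 : ℝ) ≤ 2)]; norm_num) zero_le_one (by norm_num)
  ⟨C₀, CP, δ₀, ε₀, h1, h2, h3, h4⟩

end Summit.QuantumFields.BalabanUV.T4Continuum.NE7b.SupZdPerturbedResponseTorusLimit
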